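import Mathlib.CategoryTheory.Whiskering
import Mathlib.CategoryTheory.Equivalence
import Mathlib.CategoryTheory.Endomorphism
import Mathlib.Algebra.Group.Units.Hom
import Literature.AlgebraicGeometry.Frobenioids.Frobenioid
import Literature.AlgebraicGeometry.Frobenioids.PreFrobenioidDataOfFunctor
import Literature.AlgebraicGeometry.Frobenioids.EquivalenceUnitsTransport
import Literature.AlgebraicGeometry.Frobenioids.BaseCategoryTheoreticityDefs
import Literature.AlgebraicGeometry.Frobenioids.BaseIdentityPreStepsProofs
import Literature.AlgebraicGeometry.Frobenioids.BaseIdentityPreStepsHomProofs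
import HarnessLib

/-!
# Frobenioids I, Proposition 3.3 (i), forward direction: base-identity via Frobenius-slimness — PROOF

Mochizuki, *The geometry of Frobenioids I: the general theory*, Kyushu J. Math. **62** (2008),
kurims text pp. 59–60 [cite: MochizukiFrdI2008, Prop. 3.3 (i) pp.59-60]:

> "since the composite of the functor `C^pl-bk_A → C` with the natural projection functor `C → D`
> factors as the composite of the equivalence of categories of Definition 1.3, (i), (c),
> `C^pl-bk_A ⥲ D_{A_D}` with the natural functor `D_{A_D} → D`, it follows that any homomorphism of
> monoids `𝔽 → End(C^pl-bk_A → C)^bs-iso` determines a homomorphism of monoids `𝔽 → Aut(D_{A_D} → D)`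
> — which, if `D` is Frobenius-slim, necessarily factors through the natural surjection `𝔽 ↠ N_{≥1}`".

PROVED here for Frobenioids `F : C → F_Φ` (abc-iut node `FrdI:Prop3.3(i)`, forward direction,
base-identity half), with the data of a homomorphism `𝔽 → End(C^pl-bk_A → C)^bs-iso` given — as in
`BaseCategoryTheoreticityDefs.Prop33i_forward` (seat abc-iut-L1-t3) — by the images `Γ` of
`γ = (1,1)` and `Δ_d` of `(0,d)`, subject to `Δ_d Γ = Γ^d Δ_d` AND to the remaining relations of
`𝔽 = ℤ_{≥0} ⋊ N_{≥1}`: `d ↦ Δ_d` multiplicative and unital (these two hypotheses are what makes the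
printed argument applicable; the typed `Prop33i_forward` omits them — recorded as a finding to the
statement's owner, not restated here as a named fact). Ingredients: `StandardFrobenioid.exists_hom`
(homomorphisms out of `𝔽` from a semiconjugating pair), `IsFrobeniusSlim.eq_one`, the transport of a
natural family of base-isomorphisms along the equivalence `C^pl-bk_A ⥲ D_{A_D}` (Def. 1.3 (i)(c),
`IsFrobenioid.i_c`) to an automorphism of `D_{A_D} → D` (the adapter lemma
`PreFrobenioidData.ofFunctor_isPullbackMorphism` is imported from `EquivalenceUnitsTransport.lean`); finally `prop33i_forward_holds : Prop33i_forward (ofFunctor Φ F) A`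
— the statement AS TYPED (homomorphism form) for every Frobenioid. No new definitions.
-/

namespace Literature.AlgebraicGeometry.Frobenioids

open CategoryTheory

universe w v v' u u'

/-- In a Frobenius-slim category, an automorphism `Θ` of `E_X → E` that is semi-conjugate to all its
powers through a homomorphism `Λ : N_{≥1} → Aut(E_X → E)` (`Λ_d Θ = Θ^d Λ_d`) is trivial: the
homomorphism `𝔽 → Aut(E_X → E)` it defines factors through `𝔽 ↠ N_{≥1}`, which kills `γ`
(FrdI Def. 3.1 (i) p. 56). [cite: MochizukiFrdI2008, Def. 3.1 (i) p.56] -/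
theorem IsFrobeniusSlim.eq_one {E : Type u} [Category.{v} E] (hE : IsFrobeniusSlim E) (X : E)
    (Θ : Aut (Over.forget X)) (Λ : ℕ+ →* Aut (Over.forget X))
    (h : ∀ n : ℕ+, Λ n * Θ = Θ ^ (n : ℕ) * Λ n) : Θ = 1 := by
  obtain ⟨f, hf, -⟩ := StandardFrobenioid.exists_hom Θ Λ h
  obtain ⟨g, hg⟩ := hE.factors X f
  rw [← hf, hg, MonoidHom.comp_apply]
  show g (1 : ℕ+) = 1
  exact map_one g

namespace PreFrobenioidData

variable {D : Type u} [Category.{v} D] {Φ : Dᵒᵖ ⥤ CommMonCat.{w}} {C : Type u'} [Category.{v'} C]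
  (F : C ⥤ ElemFrobenioid Φ)

/-- Isomorphisms are pull-back morphisms (FrdI Rem. 1.2.1 p. 24), in the `∃!`-form of the interface and for
every `S`; in particular the binder `hA : S.IsPullbackMorphism (𝟙 A)` of `Prop33i_converse` is always
available (`isPullbackMorphism_id`). [cite: MochizukiFrdI2008, Rem. 1.2.1 p.24] -/
theorem isPullbackMorphism_of_isIso' {C : Type u'} [Category.{v'} C] {D : Type u} [Category.{v} D]
    (S : PreFrobenioidData.{w} C D) {A B : C} (φ : A ⟶ B) [IsIso φ] : S.IsPullbackMorphism φ := by
  intro X χ β h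
  refine ⟨χ ≫ inv φ, ⟨by rw [Category.assoc, IsIso.inv_hom_id, Category.comp_id], ?_⟩, fun ψ hψ => ?_⟩
  · rw [Functor.map_comp, Functor.map_inv, ← h, Category.assoc, IsIso.hom_inv_id, Category.comp_id]
  · rw [← hψ.1, Category.assoc, IsIso.hom_inv_id, Category.comp_id]

/-- The identity is a pull-back morphism (for every `S`). [cite: MochizukiFrdI2008, Rem. 1.2.1 p.24] -/
theorem isPullbackMorphism_id {C : Type u'} [Category.{v'} C] {D : Type u} [Category.{v} D]
    (S : PreFrobenioidData.{w} C D) (A : C) : S.IsPullbackMorphism (𝟙 A) :=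
  S.isPullbackMorphism_of_isIso' (𝟙 A)

end PreFrobenioidData

namespace PreFrobenioid

variable {D : Type u} [Category.{v} D] {Φ : Dᵒᵖ ⥤ CommMonCat.{w}} {C : Type u'} [Category.{v'} C]
  {F : C ⥤ ElemFrobenioid Φ}

/-- **Prop. 3.3 (i), forward direction** [FrdI p. 59, proof p. 60], for a Frobenioid `F : C → F_Φ` over
a Frobenius-slim `D`: for a homomorphism `𝔽 → End(C^pl-bk_A → C)^bs-iso` — given by the images `Γ` of
`γ = (1,1)` and `Δ_d` of `(0,d)` with `Δ_d Γ = Γ^d Δ_d`, `d ↦ Δ_d` multiplicative and unital — every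
component `Γ_φ` of the image of `1 ∈ ℤ_{≥0}` is a base-identity pre-step, i.e. lies in `O^▷(B)`.
[cite: MochizukiFrdI2008, Prop. 3.3 (i) p.59] -/
theorem prop33i_forward_of_hom (hF : IsFrobenioid F) (hD : IsFrobeniusSlim D) (A : C)
    (Γ : (PreFrobenioidData.ofFunctor Φ F).EndPlbkBsIso A)
    (Δ : ℕ+ → (PreFrobenioidData.ofFunctor Φ F).EndPlbkBsIso A)
    (hrel : ∀ (d : ℕ+) ⦃B : C⦄ (φ : B ⟶ A) (hφ : (PreFrobenioidData.ofFunctor Φ F).IsPullbackMorphism φ),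
      (Δ d).app φ hφ * Γ.app φ hφ = Γ.app φ hφ ^ (d : ℕ) * (Δ d).app φ hφ)
    (hΔ1 : ∀ ⦃B : C⦄ (φ : B ⟶ A) (hφ : (PreFrobenioidData.ofFunctor Φ F).IsPullbackMorphism φ),
      (Δ 1).app φ hφ = 1)
    (hΔmul : ∀ (d e : ℕ+) ⦃B : C⦄ (φ : B ⟶ A)
      (hφ : (PreFrobenioidData.ofFunctor Φ F).IsPullbackMorphism φ),
      (Δ (d * e)).app φ hφ = (Δ d).app φ hφ * (Δ e).app φ hφ)
    ⦃B : C⦄ (φ : B ⟶ A) (hφ : (PreFrobenioidData.ofFunctor Φ F).IsPullbackMorphism φ) :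
    Γ.app φ hφ ∈ (PreFrobenioidData.ofFunctor Φ F).endSubmonoid B := by
  classical
  refine ⟨?_, (PreFrobenioidData.ofFunctor Φ F).prop33i_forward_isLinear A Γ Δ hrel φ hφ⟩
  -- Def. 1.3 (i)(c): the equivalence `E : C^pl-bk_A ⥲ D_{A_D}` and the forgetful `U : D_{A_D} → D`
  let A' : PullbackCat F := ⟨A⟩
  let E := pullbackSliceToBase F A
  haveI : E.IsEquivalence := hF.i_c A
  let X₀ : D := (wideSubcategoryInclusion (pullbackMorphisms F) ⋙ baseFunctor F).obj A'
  let U : Over X₀ ⥤ D := Over.forget X₀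
  -- every structure arrow of `C^pl-bk_A` is a pull-back morphism, in the interface's form
  have hpb : ∀ p : Over A', (PreFrobenioidData.ofFunctor Φ F).IsPullbackMorphism p.hom.hom := fun p =>
    (PreFrobenioidData.ofFunctor_isPullbackMorphism F _).mpr p.hom.property
  -- a natural family of endomorphisms over `A` gives an endomorphism of `E ⋙ U`
  let θ : (PreFrobenioidData.ofFunctor Φ F).EndPlbkBsIso A → End (E ⋙ U) := fun N =>
    { app := fun p => Base F (N.app p.hom.hom (hpb p))
      naturality := by
        intro p p' f
        have hg : f.left.hom ≫ p'.hom.hom = p.hom.hom := congrArg (fun k => k.hom) (Over.w f)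
        have := N.naturality p'.hom.hom (hpb p') p.hom.hom (hpb p) f.left.hom hg
        show Base F f.left.hom ≫ Base F (N.app p'.hom.hom (hpb p')) =
          Base F (N.app p.hom.hom (hpb p)) ≫ Base F f.left.hom
        rw [← base_comp, ← base_comp, this] }
  have θ_app : ∀ (N : (PreFrobenioidData.ofFunctor Φ F).EndPlbkBsIso A) (p : Over A'),
      (θ N).app p = Base F (N.app p.hom.hom (hpb p)) := fun _ _ => rfl
  have hext : ∀ a b : End (E ⋙ U), (∀ p, a.app p = b.app p) → a = b :=
    fun a b h => NatTrans.ext (funext h)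
  -- `θ` is multiplicative componentwise: powers, the relation, unit, products
  have θ_pow_app : ∀ (N : (PreFrobenioidData.ofFunctor Φ F).EndPlbkBsIso A) (n : ℕ) (p : Over A'),
      (θ N ^ n).app p = Base F (N.app p.hom.hom (hpb p) ^ n) := by
    intro N n p
    induction n with
    | zero => exact (base_id F _).symm
    | succ n ih =>
      show (θ N).app p ≫ (θ N ^ n).app p = Base F (N.app p.hom.hom (hpb p) ≫ N.app p.hom.hom (hpb p) ^ n)
      exact (congrArg (fun t => (θ N).app p ≫ t) ih).trans (base_comp F _ _).symm
  have hrelθ : ∀ d : ℕ+, θ (Δ d) * θ Γ = θ Γ ^ (d : ℕ) * θ (Δ d) := by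
    intro d
    apply hext
    intro p
    show Base F (Γ.app p.hom.hom (hpb p)) ≫ Base F ((Δ d).app p.hom.hom (hpb p)) =
      Base F ((Δ d).app p.hom.hom (hpb p)) ≫ (θ Γ ^ (d : ℕ)).app p
    exact (base_comp F _ _).symm.trans <| (congrArg (Base F) (hrel d p.hom.hom (hpb p))).trans <|
      (base_comp F _ _).trans <| congrArg (fun t => Base F ((Δ d).app p.hom.hom (hpb p)) ≫ t)
        (θ_pow_app Γ d p).symm
  have hθ1 : θ (Δ 1) = 1 := by
    apply hext
    intro p
    show Base F ((Δ 1).app p.hom.hom (hpb p)) = 𝟙 _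
    exact (congrArg (Base F) (hΔ1 p.hom.hom (hpb p))).trans (base_id F _)
  have hθmul : ∀ d e : ℕ+, θ (Δ (d * e)) = θ (Δ d) * θ (Δ e) := by
    intro d e
    apply hext
    intro p
    show Base F ((Δ (d * e)).app p.hom.hom (hpb p)) =
      Base F ((Δ e).app p.hom.hom (hpb p)) ≫ Base F ((Δ d).app p.hom.hom (hpb p))
    exact (congrArg (Base F) (hΔmul d e p.hom.hom (hpb p))).trans (base_comp F _ _)
  -- each `θ N` is a unit (its components are base-isomorphisms)
  have hunit : ∀ N : (PreFrobenioidData.ofFunctor Φ F).EndPlbkBsIso A, IsUnit (θ N) := by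
    intro N
    rw [isUnit_iff_isIso]
    haveI : ∀ p : Over A', IsIso ((θ N).app p) := fun p => N.isBaseIso p.hom.hom (hpb p)
    exact NatIso.isIso_of_isIso_app _
  -- the homomorphism `𝔽 → (End (E ⋙ U))ˣ`
  let Θu : (End (E ⋙ U))ˣ := (hunit Γ).unit
  let Λu : ℕ+ →* (End (E ⋙ U))ˣ :=
    { toFun := fun d => (hunit (Δ d)).unit
      map_one' := Units.ext (by rw [IsUnit.unit_spec, Units.val_one, hθ1])
      map_mul' := fun d e => Units.ext (by rw [IsUnit.unit_spec, Units.val_mul, IsUnit.unit_spec,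
        IsUnit.unit_spec, hθmul]) }
  have hrelu : ∀ n : ℕ+, Λu n * Θu = Θu ^ (n : ℕ) * Λu n := fun n =>
    Units.ext (by
      rw [Units.val_mul, Units.val_mul, Units.val_pow_eq_pow_val]
      show θ (Δ n) * θ Γ = θ Γ ^ (n : ℕ) * θ (Δ n)
      exact hrelθ n)
  -- transport to `Aut(D_{A_D} → D)` along `(End _)ˣ ≃ Aut (E ⋙ U) ≃ Aut U` (whiskering by `E`)
  have hW : ((Functor.whiskeringLeft (Over A') (Over X₀) D).obj E).FullyFaithful :=
    Functor.FullyFaithful.ofFullyFaithful _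
  let e₁ : (End (E ⋙ U))ˣ ≃* Aut (E ⋙ U) := Aut.unitsEndEquivAut (E ⋙ U)
  let e₂ : Aut U ≃* Aut (E ⋙ U) := hW.autMulEquivOfFullyFaithful U
  let ι : (End (E ⋙ U))ˣ →* Aut U := e₂.symm.toMonoidHom.comp e₁.toMonoidHom
  have hone : ι Θu = 1 :=
    IsFrobeniusSlim.eq_one hD X₀ (ι Θu) (ι.comp Λu) fun n => by
      show ι (Λu n) * ι Θu = ι Θu ^ (n : ℕ) * ι (Λu n)
      rw [← map_pow, ← map_mul, ← map_mul, hrelu]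
  have hΘ : θ Γ = 1 := by
    have h1 : Θu = 1 := by
      have hinj : Function.Injective ι := e₂.symm.injective.comp e₁.injective
      exact hinj (by rw [hone, map_one])
    have := congrArg Units.val h1
    rwa [IsUnit.unit_spec, Units.val_one] at this
  -- read off the component at `(B, φ)`
  have hφ' : pullbackMorphisms F φ := (PreFrobenioidData.ofFunctor_isPullbackMorphism F φ).mp hφ
  let p₀ : Over A' := Over.mk (⟨φ, hφ'⟩ : (⟨B⟩ : PullbackCat F) ⟶ A')
  have key := congrArg (fun t : End (E ⋙ U) => t.app p₀) hΘ
  exact key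

/-- **Prop. 3.3 (i)**, forward direction AS TYPED (`Prop33i_forward`, the homomorphism form), for the
operations of every Frobenioid `F : C → F_Φ`: if `D` is Frobenius-slim, the components of the image of
`1 ∈ ℤ_{≥0} ⊆ 𝔽` under any homomorphism `𝔽 → End(C^pl-bk_A → C)^bs-iso` are base-identity pre-steps.
With `prop33i_converse_holds` this discharges node `FrdI:Prop3.3(i)`. [cite: MochizukiFrdI2008, Prop. 3.3 (i) p.59] -/
theorem prop33i_forward_holds (hF : IsFrobenioid F) (A : C) :
    Prop33i_forward (PreFrobenioidData.ofFunctor Φ F) A := by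
  intro hD f B φ hφ
  obtain ⟨hrel, h1, hmul⟩ := (PreFrobenioidData.ofFunctor Φ F).hom_component_relations f
  exact prop33i_forward_of_hom hF hD A (f StandardFrobenioid.gen) (fun d => f (StandardFrobenioid.degSection d))
    hrel h1 hmul φ hφ

end PreFrobenioid

end Literature.AlgebraicGeometry.Frobenioids
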